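import Mathlib
import Summits.ValiantsHypothesis.ValiantsHypothesis.Theorems.KPlusLogSqLawWeakLiftingTowerGraftSignedCrossingDegenerate

/-!
# Tower graft line — SIGNED CROSSINGS X: the co-Euler SIGNATURE LAW for one-letter grafts (regular and degenerate kernels)

Structure file for LINE (B) `Cruxes/WeakLifting/Lines/tower_graft.lean` (crux `WeakLifting` = stmt-ValiantsHypothesis-19561),
tenth of the SIGNED-CROSSING series: files VIII–IX specialised to the line's object, the one-letter graft `F = G + u^D S`,
`G = Σ_l u^{d_l}S_l` (`d_l ≤ D`, symmetric letters), ANY symmetric far letter `S`.  At a root `t` the kernel crossing form of `F` is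
`−vᵀ((D − θ)G)(t)v / t` (file IV: the far letter is invisible), so frames in `ker F(t)` on which the CO-EULER BASE `Σ_l (D − d_l)t^{d_l}S_l` is
NEGATIVE are upward directions and frames on which it is POSITIVE are downward directions.

§1 `graft_crossing_frames` — the translation: co-Euler-negative (resp. -positive) frames in `ker F(t)` are positive (resp. negative) frames
   for the entrywise derivative of `F`.
§2 ★★ `graft_signature` — CO-EULER SIGNATURE LAW (regular kernels): `0 < a ≤ b` non-roots of `det F`, `T ⊆ (a, b)` finite containing the
   roots, at each `t ∈ T` frames `Qn t` (co-Euler base negative) and `Qq t` (co-Euler base positive) in `ker F(t)` with `|κn t| + |κq t| = ν₀(F t)`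
   ⇒ `Σ_t |κn t| + ν₋(F b) = Σ_t |κq t| + ν₋(F a)` — the flux of the graft through the zone is the total CO-EULER SIGNATURE of its root
   kernels, for every far letter (file V's `graft_balance` is the case of definite kernels).
§3 ★★ `graft_signature_degenerate` — the same with ANY partial frames (isotropic kernel directions = folds allowed):
   `Σ_t 2|κn t| + ν₋(F b) ≤ Σ_t ν₀(F t) + ν₋(F a)` and `Σ_t 2|κq t| + ν₋(F a) ≤ Σ_t ν₀(F t) + ν₋(F b)`; and `graft_negCount_dist_le`
   (no frames: the graft's negative inertia moves by at most the total kernel mass of the roots in the zone).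
READING FOR THE LINE (honest): in any zone, (co-Euler-negative kernel mass) − (co-Euler-positive kernel mass) = inertia flux `∈ [−m, m]`, up to
one unit per isotropic kernel direction met; a class-currency bound on the co-Euler-positive mass plus the fold mass would bound the graft's
roots in the zone.  Neither is claimed (S4/S5/T3 content).  Zero stub credit; S4/S5, TowerB, WeakLifting, Conjecture B, 18050, VP ≠ VNP
untouched.  Def-free; Mathlib + files I–IX.  Seat: prover val-sym-lift-p2 g24, `--supports stmt-ValiantsHypothesis-19561 --as helper`.
[this work, on folklore]
-/

-- `Summit.ValiantsHypothesis.ValiantsHypothesis.…` repeats a component by the D-0017 layout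
-- (single-conjunct summit), which the `dupNamespace` linter flags; the name is mandated.
set_option linter.dupNamespace false
set_option autoImplicit false

namespace Summit.ValiantsHypothesis.ValiantsHypothesis.Theorems.KPlusLogSqLaw.TowerGraft

open Matrix Finset Filter
open scoped BigOperators Topology

namespace SignedCrossing

variable {m K : ℕ}

/-! ## §1 Co-Euler frames are crossing frames -/

/-- the graft as a differentiable family: entrywise derivative (snoc exponent family) and the crossing identity on the kernel
`t · vᵀF′(t)v = −vᵀ(Σ_l (D − d_l)t^{d_l}S_l)v`. [file IV, repackaged] -/
theorem graft_hasDerivAt_and_crossing (D : ℕ) (d : Fin K → ℕ) (hdD : ∀ l, d l ≤ D) (S : Fin K → Matrix (Fin m) (Fin m) ℝ)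
    (Sfar : Matrix (Fin m) (Fin m) ℝ) :
    (∀ u (i j : Fin m), HasDerivAt (fun x => ((∑ l, (x ^ d l) • S l) + (x ^ D) • Sfar) i j)
        ((∑ l : Fin (K + 1), (((Fin.snoc d D : Fin (K + 1) → ℕ) l : ℝ) * u ^ ((Fin.snoc d D : Fin (K + 1) → ℕ) l - 1)) •
          (Fin.snoc S Sfar : Fin (K + 1) → _) l) i j) u) ∧
      ∀ t, ∀ v : Fin m → ℝ, ((∑ l, (t ^ d l) • S l) + (t ^ D) • Sfar) *ᵥ v = 0 →
        t * (v ⬝ᵥ (∑ l : Fin (K + 1), (((Fin.snoc d D : Fin (K + 1) → ℕ) l : ℝ) * t ^ ((Fin.snoc d D : Fin (K + 1) → ℕ) l - 1)) •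
            (Fin.snoc S Sfar : Fin (K + 1) → _) l) *ᵥ v) =
          -(v ⬝ᵥ (∑ l, (((D - d l : ℕ) : ℝ) * t ^ d l) • S l) *ᵥ v) := by
  have hfam : ∀ u : ℝ, (∑ l, (u ^ (Fin.snoc d D : Fin (K + 1) → ℕ) l) • (Fin.snoc S Sfar : Fin (K + 1) → _) l) =
      (∑ l, (u ^ d l) • S l) + (u ^ D) • Sfar := fun u => (graft_eq_family D d S Sfar u).symm
  constructor
  · intro u i j
    have h := hasDerivAt_family (Fin.snoc d D) (Fin.snoc S Sfar) u i j
    have hfun : (fun x : ℝ => (∑ l, (x ^ (Fin.snoc d D : Fin (K + 1) → ℕ) l) • (Fin.snoc S Sfar : Fin (K + 1) → _) l) i j) =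
        fun x => ((∑ l, (x ^ d l) • S l) + (x ^ D) • Sfar) i j := funext fun x => by rw [hfam x]
    rwa [hfun] at h
  · intro t v hv
    have hv' : (∑ l, (t ^ (Fin.snoc d D : Fin (K + 1) → ℕ) l) • (Fin.snoc S Sfar : Fin (K + 1) → _) l) *ᵥ v = 0 := by
      rw [hfam t]; exact hv
    rw [mul_crossingForm_eq (Fin.snoc d D) (Fin.snoc S Sfar) t v, ← eulerShiftForm_eq_of_mem_ker (Fin.snoc d D) (Fin.snoc S Sfar) t (D : ℝ) v hv']
    exact eulerShiftForm_snoc_eq D d hdD S Sfar t v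

/-- **co-Euler frames are crossing frames**: for `t > 0` and a frame `Q` in `ker F(t)`, if the co-Euler base is NEGATIVE on `col Q ∖ 0` then the
derivative of `F` is positive there, and if it is POSITIVE there then the derivative is negative. [this work] -/
theorem graft_crossing_frames (D : ℕ) (d : Fin K → ℕ) (hdD : ∀ l, d l ≤ D) (S : Fin K → Matrix (Fin m) (Fin m) ℝ)
    (Sfar : Matrix (Fin m) (Fin m) ℝ) {t : ℝ} (ht : 0 < t) {κ : Type} [Fintype κ] (Q : Matrix (Fin m) κ ℝ)
    (hQker : ∀ c : κ → ℝ, ((∑ l, (t ^ d l) • S l) + (t ^ D) • Sfar) *ᵥ (Q *ᵥ c) = 0) :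
    ((∀ c : κ → ℝ, c ≠ 0 → (Q *ᵥ c) ⬝ᵥ (∑ l, (((D - d l : ℕ) : ℝ) * t ^ d l) • S l) *ᵥ (Q *ᵥ c) < 0) →
      ∀ c : κ → ℝ, c ≠ 0 → 0 < (Q *ᵥ c) ⬝ᵥ (∑ l : Fin (K + 1), (((Fin.snoc d D : Fin (K + 1) → ℕ) l : ℝ) *
        t ^ ((Fin.snoc d D : Fin (K + 1) → ℕ) l - 1)) • (Fin.snoc S Sfar : Fin (K + 1) → _) l) *ᵥ (Q *ᵥ c)) ∧
    ((∀ c : κ → ℝ, c ≠ 0 → 0 < (Q *ᵥ c) ⬝ᵥ (∑ l, (((D - d l : ℕ) : ℝ) * t ^ d l) • S l) *ᵥ (Q *ᵥ c)) →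
      ∀ c : κ → ℝ, c ≠ 0 → (Q *ᵥ c) ⬝ᵥ (∑ l : Fin (K + 1), (((Fin.snoc d D : Fin (K + 1) → ℕ) l : ℝ) *
        t ^ ((Fin.snoc d D : Fin (K + 1) → ℕ) l - 1)) • (Fin.snoc S Sfar : Fin (K + 1) → _) l) *ᵥ (Q *ᵥ c) < 0) := by
  have hcross := (graft_hasDerivAt_and_crossing D d hdD S Sfar).2 t
  constructor
  · intro hneg c hc
    have h1 := hneg c hc
    have h2 := hcross (Q *ᵥ c) (hQker c)
    have h3 : 0 < t * ((Q *ᵥ c) ⬝ᵥ (∑ l : Fin (K + 1), (((Fin.snoc d D : Fin (K + 1) → ℕ) l : ℝ) *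
        t ^ ((Fin.snoc d D : Fin (K + 1) → ℕ) l - 1)) • (Fin.snoc S Sfar : Fin (K + 1) → _) l) *ᵥ (Q *ᵥ c)) := by
      rw [h2]; linarith
    exact pos_of_mul_pos_right h3 ht.le
  · intro hpos c hc
    have h1 := hpos c hc
    have h2 := hcross (Q *ᵥ c) (hQker c)
    have h3 : t * ((Q *ᵥ c) ⬝ᵥ (∑ l : Fin (K + 1), (((Fin.snoc d D : Fin (K + 1) → ℕ) l : ℝ) *
        t ^ ((Fin.snoc d D : Fin (K + 1) → ℕ) l - 1)) • (Fin.snoc S Sfar : Fin (K + 1) → _) l) *ᵥ (Q *ᵥ c)) < 0 := by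
      rw [h2]; linarith
    exact lt_of_not_ge fun hge => absurd h3 (not_lt.mpr (mul_nonneg ht.le hge))

/-! ## §2 The co-Euler signature law -/

/-- **CO-EULER SIGNATURE LAW FOR ONE-LETTER GRAFTS (regular kernels).**  `F = G + u^D S_far`, `0 < a ≤ b` with `det F(a) ≠ 0 ≠ det F(b)`,
`T ⊆ (a, b)` finite containing the roots of `det F`; at each `t ∈ T` frames `Qn t` / `Qq t` in `ker F(t)` on which the co-Euler base form
`vᵀ(Σ_l (D − d_l)t^{d_l}S_l)v` is negative / positive, with `|κn t| + |κq t| = ν₀(F t)`.  Then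
`Σ_t |κn t| + ν₋(F b) = Σ_t |κq t| + ν₋(F a)`. [this work] -/
theorem graft_signature (D : ℕ) (d : Fin K → ℕ) (hdD : ∀ l, d l ≤ D) (S : Fin K → Matrix (Fin m) (Fin m) ℝ) (hS : ∀ l, (S l).IsSymm)
    (Sfar : Matrix (Fin m) (Fin m) ℝ) (hSfar : Sfar.IsSymm) {a b : ℝ} (ha : 0 < a) (hab : a ≤ b)
    (ha0 : ((∑ l, (a ^ d l) • S l) + (a ^ D) • Sfar).det ≠ 0) (hb0 : ((∑ l, (b ^ d l) • S l) + (b ^ D) • Sfar).det ≠ 0)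
    (T : Finset ℝ) (hT : ∀ t ∈ T, a < t ∧ t < b)
    (hcov : ∀ u, a < u → u < b → ((∑ l, (u ^ d l) • S l) + (u ^ D) • Sfar).det = 0 → u ∈ T)
    (κn κq : ℝ → Type) [∀ t, Fintype (κn t)] [∀ t, Fintype (κq t)]
    (Qn : ∀ t, Matrix (Fin m) (κn t) ℝ) (Qq : ∀ t, Matrix (Fin m) (κq t) ℝ)
    (hQnker : ∀ t ∈ T, ∀ c : κn t → ℝ, ((∑ l, (t ^ d l) • S l) + (t ^ D) • Sfar) *ᵥ (Qn t *ᵥ c) = 0)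
    (hQn : ∀ t ∈ T, ∀ c : κn t → ℝ, c ≠ 0 → (Qn t *ᵥ c) ⬝ᵥ (∑ l, (((D - d l : ℕ) : ℝ) * t ^ d l) • S l) *ᵥ (Qn t *ᵥ c) < 0)
    (hQqker : ∀ t ∈ T, ∀ c : κq t → ℝ, ((∑ l, (t ^ d l) • S l) + (t ^ D) • Sfar) *ᵥ (Qq t *ᵥ c) = 0)
    (hQq : ∀ t ∈ T, ∀ c : κq t → ℝ, c ≠ 0 → 0 < (Qq t *ᵥ c) ⬝ᵥ (∑ l, (((D - d l : ℕ) : ℝ) * t ^ d l) • S l) *ᵥ (Qq t *ᵥ c))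
    (hreg : ∀ t ∈ T, Fintype.card (κn t) + Fintype.card (κq t) =
      (univ.filter fun i => (ZoneFlux.isHermitian_graft D d S hS Sfar hSfar t).eigenvalues i = 0).card) :
    (∑ t ∈ T, Fintype.card (κn t)) + (univ.filter fun i => (ZoneFlux.isHermitian_graft D d S hS Sfar hSfar b).eigenvalues i < 0).card =
      (∑ t ∈ T, Fintype.card (κq t)) + (univ.filter fun i => (ZoneFlux.isHermitian_graft D d S hS Sfar hSfar a).eigenvalues i < 0).card := by
  obtain ⟨hd, -⟩ := graft_hasDerivAt_and_crossing D d hdD S Sfar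
  have hpos : ∀ t ∈ T, 0 < t := fun t ht => ha.trans (hT t ht).1
  exact sum_card_pos_add_negCount_eq_sum_card_neg_add_negCount (fun u => (∑ l, (u ^ d l) • S l) + (u ^ D) • Sfar) _
    (fun u => ZoneFlux.isHermitian_graft D d S hS Sfar hSfar u) (fun u _ _ i j => hd u i j) hab ha0 hb0 T hT hcov κn κq Qn Qq
    hQnker (fun t ht => (graft_crossing_frames D d hdD S Sfar (hpos t ht) (Qn t) (hQnker t ht)).1 (hQn t ht))
    hQqker (fun t ht => (graft_crossing_frames D d hdD S Sfar (hpos t ht) (Qq t) (hQqker t ht)).2 (hQq t ht)) hreg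

/-! ## §3 The degenerate-tolerant form -/

/-- **CO-EULER SIGNATURE LAW, DEGENERATE-TOLERANT.**  Same setting with ANY partial frames (no completeness):
`Σ_t 2|κn t| + ν₋(F b) ≤ Σ_t ν₀(F t) + ν₋(F a)` and `Σ_t 2|κq t| + ν₋(F a) ≤ Σ_t ν₀(F t) + ν₋(F b)` — each kernel direction of a root that is
isotropic for the co-Euler base (a fold) loosens the balance by at most one. [this work] -/
theorem graft_signature_degenerate (D : ℕ) (d : Fin K → ℕ) (hdD : ∀ l, d l ≤ D) (S : Fin K → Matrix (Fin m) (Fin m) ℝ)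
    (hS : ∀ l, (S l).IsSymm) (Sfar : Matrix (Fin m) (Fin m) ℝ) (hSfar : Sfar.IsSymm) {a b : ℝ} (ha : 0 < a) (hab : a ≤ b)
    (ha0 : ((∑ l, (a ^ d l) • S l) + (a ^ D) • Sfar).det ≠ 0) (hb0 : ((∑ l, (b ^ d l) • S l) + (b ^ D) • Sfar).det ≠ 0)
    (T : Finset ℝ) (hT : ∀ t ∈ T, a < t ∧ t < b)
    (hcov : ∀ u, a < u → u < b → ((∑ l, (u ^ d l) • S l) + (u ^ D) • Sfar).det = 0 → u ∈ T)
    (κn κq : ℝ → Type) [∀ t, Fintype (κn t)] [∀ t, Fintype (κq t)]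
    (Qn : ∀ t, Matrix (Fin m) (κn t) ℝ) (Qq : ∀ t, Matrix (Fin m) (κq t) ℝ)
    (hQnker : ∀ t ∈ T, ∀ c : κn t → ℝ, ((∑ l, (t ^ d l) • S l) + (t ^ D) • Sfar) *ᵥ (Qn t *ᵥ c) = 0)
    (hQn : ∀ t ∈ T, ∀ c : κn t → ℝ, c ≠ 0 → (Qn t *ᵥ c) ⬝ᵥ (∑ l, (((D - d l : ℕ) : ℝ) * t ^ d l) • S l) *ᵥ (Qn t *ᵥ c) < 0)
    (hQqker : ∀ t ∈ T, ∀ c : κq t → ℝ, ((∑ l, (t ^ d l) • S l) + (t ^ D) • Sfar) *ᵥ (Qq t *ᵥ c) = 0)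
    (hQq : ∀ t ∈ T, ∀ c : κq t → ℝ, c ≠ 0 → 0 < (Qq t *ᵥ c) ⬝ᵥ (∑ l, (((D - d l : ℕ) : ℝ) * t ^ d l) • S l) *ᵥ (Qq t *ᵥ c)) :
    (∑ t ∈ T, 2 * Fintype.card (κn t)) + (univ.filter fun i => (ZoneFlux.isHermitian_graft D d S hS Sfar hSfar b).eigenvalues i < 0).card ≤
        (∑ t ∈ T, (univ.filter fun i => (ZoneFlux.isHermitian_graft D d S hS Sfar hSfar t).eigenvalues i = 0).card) +
          (univ.filter fun i => (ZoneFlux.isHermitian_graft D d S hS Sfar hSfar a).eigenvalues i < 0).card ∧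
      (∑ t ∈ T, 2 * Fintype.card (κq t)) + (univ.filter fun i => (ZoneFlux.isHermitian_graft D d S hS Sfar hSfar a).eigenvalues i < 0).card ≤
        (∑ t ∈ T, (univ.filter fun i => (ZoneFlux.isHermitian_graft D d S hS Sfar hSfar t).eigenvalues i = 0).card) +
          (univ.filter fun i => (ZoneFlux.isHermitian_graft D d S hS Sfar hSfar b).eigenvalues i < 0).card := by
  obtain ⟨hd, -⟩ := graft_hasDerivAt_and_crossing D d hdD S Sfar
  have hpos : ∀ t ∈ T, 0 < t := fun t ht => ha.trans (hT t ht).1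
  exact two_mul_sum_card_add_negCount_le (fun u => (∑ l, (u ^ d l) • S l) + (u ^ D) • Sfar) _
    (fun u => ZoneFlux.isHermitian_graft D d S hS Sfar hSfar u) (fun u _ _ i j => hd u i j) hab ha0 hb0 T hT hcov κn κq Qn Qq
    hQnker (fun t ht => (graft_crossing_frames D d hdD S Sfar (hpos t ht) (Qn t) (hQnker t ht)).1 (hQn t ht))
    hQqker (fun t ht => (graft_crossing_frames D d hdD S Sfar (hpos t ht) (Qq t) (hQqker t ht)).2 (hQq t ht))

/-- **no frames**: through any zone with non-root ends, the negative inertia of a one-letter graft moves by at most the total kernel mass of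
the roots inside — `|ν₋(F a) − ν₋(F b)| ≤ Σ_{roots} ν₀(F t)`. [this work] -/
theorem graft_negCount_dist_le (D : ℕ) (d : Fin K → ℕ) (hdD : ∀ l, d l ≤ D) (S : Fin K → Matrix (Fin m) (Fin m) ℝ)
    (hS : ∀ l, (S l).IsSymm) (Sfar : Matrix (Fin m) (Fin m) ℝ) (hSfar : Sfar.IsSymm) {a b : ℝ} (hab : a ≤ b)
    (ha0 : ((∑ l, (a ^ d l) • S l) + (a ^ D) • Sfar).det ≠ 0) (hb0 : ((∑ l, (b ^ d l) • S l) + (b ^ D) • Sfar).det ≠ 0)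
    (T : Finset ℝ) (hT : ∀ t ∈ T, a < t ∧ t < b)
    (hcov : ∀ u, a < u → u < b → ((∑ l, (u ^ d l) • S l) + (u ^ D) • Sfar).det = 0 → u ∈ T) :
    (univ.filter fun i => (ZoneFlux.isHermitian_graft D d S hS Sfar hSfar b).eigenvalues i < 0).card ≤
        (∑ t ∈ T, (univ.filter fun i => (ZoneFlux.isHermitian_graft D d S hS Sfar hSfar t).eigenvalues i = 0).card) +
          (univ.filter fun i => (ZoneFlux.isHermitian_graft D d S hS Sfar hSfar a).eigenvalues i < 0).card ∧
      (univ.filter fun i => (ZoneFlux.isHermitian_graft D d S hS Sfar hSfar a).eigenvalues i < 0).card ≤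
        (∑ t ∈ T, (univ.filter fun i => (ZoneFlux.isHermitian_graft D d S hS Sfar hSfar t).eigenvalues i = 0).card) +
          (univ.filter fun i => (ZoneFlux.isHermitian_graft D d S hS Sfar hSfar b).eigenvalues i < 0).card := by
  obtain ⟨hd, -⟩ := graft_hasDerivAt_and_crossing D d hdD S Sfar
  exact negCount_dist_le_sum_zeroCount (fun u => (∑ l, (u ^ d l) • S l) + (u ^ D) • Sfar) _
    (fun u => ZoneFlux.isHermitian_graft D d S hS Sfar hSfar u) (fun u _ _ i j => hd u i j) hab ha0 hb0 T hT hcov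

end SignedCrossing

end Summit.ValiantsHypothesis.ValiantsHypothesis.Theorems.KPlusLogSqLaw.TowerGraft
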